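import Summits.BirchSwinnertonDyer.BirchSwinnertonDyer.Theorems.GenusKolyvaginAtTwoPowDvdShaCardAtTwoRTFullOrderPairChebotarev
import Summits.BirchSwinnertonDyer.BirchSwinnertonDyer.Theorems.GenusKolyvaginAtTwoPowDvdShaCardAtTwoRTNonPhantomHres
import Summits.BirchSwinnertonDyer.BirchSwinnertonDyer.Theorems.GenusKolyvaginAtTwoVisiblePairAtTwoKolyvaginClassSign
import Summits.BirchSwinnertonDyer.BirchSwinnertonDyer.Theorems.ByReductionTypeAtTwoRankOneAtTwoBigImageOddLocalOneDoorBottomLemma43AtTwo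
import Summits.BirchSwinnertonDyer.BirchSwinnertonDyer.Theorems.GenusKolyvaginAtTwoEquivariantKolyvaginExactAtTwoPairBookkeeping
import HarnessLib

/-!
# Route `GenusKolyvaginAtTwo`, crux L_T `PowDvdShaCardAtTwoRT` (stmt-BirchSwinnertonDyer-23242), LINE 18 stub KS, the DROPS:
# THE ČEBOTAREV INPUT OF THE WEAK TWO-PRIME SWAP, DISCHARGED FROM (NPh) — a deep Kolyvagin prime of FULL local order for the Kolyvagin
# classes of TWO data (the running product and its neighbour), no third class

Width seat `bsd-line-gk2-p4` g19 (cell `bsd-f1-sign2`), `--supports 23242 --as helper`.  THEOREMS ONLY; no `sorry`; standard axioms.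
BSD is NOT proved by any of this; neither is the crux nor any stub.

WHY (memo `Cruxes/PowDvdShaCardAtTwoRT/Lines/plus-descent-drops-klein.md`; LEAD g17 09:59Z «DROPS = the open half of KS»).  The STRONG swap
oracle (`PlusDescent.swapOracle_of_twoPrimeReciprocity`) asks its new prime to detect a third class `c` — obstructed at `2` by the Klein residue
(`…RTKleinSocle`: the `±` eigen-lines of `E[2^L]` share their socle).  gk2-p2's WEAK two-prime engine
(`PlusDescent.weakSwapOracle_of_twoPrimeReciprocity` / `exists_avoiding_of_twoPrimeReciprocity_weak`, `…RTTwoPrimeSwapWeak`) needs only the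
PAIR prescription: a new admissible prime `ℓ′` at which the classes `c_L(∏(S∖ℓ₀))` and `c_L(∏S)` both have FULL local order.  This file is
that input in Kolyvagin–Heegner-datum currency, discharged from the tree: for two square-free products `n₁`, `n₂` of Zhang–Kolyvagin primes
of index `≥ L` with data `d₁`, `d₂` whose classes `c_L(d₁)`, `c_L(d₂)` have orders `2^a`, `2^b` (`a, b ≥ 1`), and ANY finite exceptional set
`S₀`, there is a Kolyvagin prime `ℓ ∉ S₀`, `ℓ ∤ n₁ n₂`, with `Frob_ℓ = Frob_∞` on `K(E[2^L])` (index `≥ L`) at whose place BOTH classes have full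
local order.  Ingredients: Gross 5.4 at `2` (signs, `KolyvaginClassSign.sign_conjAct_kolyvaginClass_two`), Gross 6.2(1) at `2` on the odd-Tamagawa
slice (`RankOneAtTwoOneDoor.kolyvaginClass_two_mem_selmerLocalKer_of_odd_tamagawaProduct`: the classes are Selmer off their own primes), the
separation hypothesis from **(NPh_L)** (`RelaxedCount.eq_zero_of_phantom_of_selmer_outside_pow`), and gk2-p2's signed full-order PAIR Čebotarev
(`PlusDescent.infinite_kolyvaginPrime_localization_fullOrder_pair`).
* §1 place bookkeeping; §2 **`exists_deep_kolyvaginPrime_fullOrder_pair_of_data`**.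
Namespace `…Theorems.GenusExact.RelaxedCount`.  Closes nothing.  BSD is NOT proved by any of this.

References: [McCallumLMS1991] §3 Cor. 3.2, §5 proof of Prop. 5.2 ((11)–(13)); [Kolyvagin1991MathAnn] Thm. 2.1; [GrossLMS1991] Prop. 5.4,
Prop. 6.2 (1), §9.
-/

set_option autoImplicit false
-- the Theorems namespace of this sub repeats the summit name by design (D-0017 nested layout)
set_option linter.dupNamespace false

noncomputable section

open scoped Classical

open Field NumberField IsDedekindDomain Function WeierstrassCurve Rat.HeightOneSpectrum
open Literature.NumberTheory.EllipticCurves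
open Literature.NumberTheory.GaloisRepresentations
open Summit.BirchSwinnertonDyer.BirchSwinnertonDyer.Theorems.GenusExact.VisiblePairAtTwo
  (natCast_mem_primesEquiv_symm natCast_prime_mem_iff_eq natCast_mem_of_liesOver)

namespace Summit.BirchSwinnertonDyer.BirchSwinnertonDyer.Theorems.GenusExact.RelaxedCount

/-! ## §1 Bookkeeping: a prime of `K` dividing a natural number lies over one of its prime factors -/

section Bookkeeping

variable {K : Type} [Field K] [NumberField K]

/-- If a finite place `w` of `K` over the place `v` of `ℚ` contains the natural number `m ≠ 0`, then `v` contains one of the prime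
factors of `m`. [folklore] -/
theorem exists_primeFactor_natCast_mem_of_natCast_mem {m : ℕ} (hm : m ≠ 0) (v : HeightOneSpectrum (𝓞 ℚ)) (w : HeightOneSpectrum (𝓞 K))
    [hwv : w.asIdeal.LiesOver v.asIdeal] (h : (m : 𝓞 K) ∈ w.asIdeal) : ∃ q ∈ m.primeFactors, (q : 𝓞 ℚ) ∈ v.asIdeal := by
  have hv : (m : 𝓞 ℚ) ∈ v.asIdeal := by
    rw [Ideal.LiesOver.over (P := w.asIdeal) (p := v.asIdeal), Ideal.under_def, Ideal.mem_comap, map_natCast]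
    exact h
  clear h
  induction m using Nat.strong_induction_on with
  | _ m ih =>
    by_cases h1 : m = 1
    · subst h1
      exact absurd (v.asIdeal.eq_top_iff_one.mpr (by exact_mod_cast hv)) v.isPrime.ne_top
    · have hqp : m.minFac.Prime := Nat.minFac_prime h1
      obtain ⟨m', hm'⟩ := Nat.minFac_dvd m
      have hm'0 : m' ≠ 0 := by
        rintro rfl
        rw [mul_zero] at hm'
        exact hm hm'
      have hcast : (m : 𝓞 ℚ) = (m.minFac : 𝓞 ℚ) * (m' : 𝓞 ℚ) := by rw [← Nat.cast_mul, ← hm']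
      rw [hcast] at hv
      rcases v.isPrime.mem_or_mem hv with hqv | hm'v
      · exact ⟨m.minFac, Nat.mem_primeFactors.mpr ⟨hqp, Nat.minFac_dvd m, hm⟩, hqv⟩
      · have hlt : m' < m := by
          rw [hm']
          exact lt_mul_of_one_lt_left (Nat.pos_of_ne_zero hm'0) hqp.one_lt
        obtain ⟨q', hq', hq'v⟩ := ih m' hlt hm'0 hm'v
        exact ⟨q', Nat.primeFactors_mono (Dvd.intro_left _ hm'.symm) hm hq', hq'v⟩

end Bookkeeping

/-! ## §2 The pair Čebotarev step of the weak two-prime swap, from (NPh) -/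

section Pair

variable (W : WeierstrassCurve ℚ) [W.IsElliptic] [W.IsGloballyMinimal]

/-- **THE ČEBOTAREV INPUT OF THE WEAK TWO-PRIME SWAP AT `2`, BY NAME.**  Frame: `E/ℚ` globally minimal, non-CM, `Δ < 0`, `ρ_{E,2^∞}` onto,
odd Tamagawa product; `K` imaginary quadratic with `d_K` odd `≠ −3`, the Heegner hypothesis and `d_K·(−|Δ|)` not a square; `σ ≠ 1`; a
level `L ≥ 1` with **(NPh_L)** (no non-zero class of `H¹(K,E[2^L])` dying on `Γ_{K(E[2^L])}` is Selmer at every finite place).  Data: two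
square-free products `n₁`, `n₂` of Zhang–Kolyvagin primes of index `≥ L` with Kolyvagin–Heegner data `d₁`, `d₂` whose level-`2^L` classes have
orders `2^a`, `2^b` (`a, b ≥ 1`), and a finite exceptional set `S₀` of primes.  CONCLUSION: a Zhang–Kolyvagin prime `ℓ ∉ S₀`, `ℓ ∤ n₁`,
`ℓ ∤ n₂`, of index `≥ L` with `Frob_ℓ = Frob_∞` on `K(E[2^L])`, at whose place(s) `c_L(d₁)` has local order EXACTLY `2^a` and `c_L(d₂)` EXACTLY
`2^b` (tree currency: `2^j·c ∈ torsionLocalKer_v ⟺ a ≤ j`).  In the weak swap (`PlusDescent.weakSwapOracle_of_twoPrimeReciprocity`):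
`n₁ = ∏(S∖ℓ₀)`, `n₂ = ∏S`; the detected bottom class `γ S = 2^{b−1} c_L(d₂)` is then visible at `ℓ` for free.  Proof: both classes are
`σ`-eigen (Gross 5.4) and Selmer off the places of `n₁ n₂` (Gross 6.2(1)); a phantom combination is therefore Selmer off those places and killed by
(NPh_L) via Φ-kill at them (index `≥ L`); gk2-p2's signed pair Čebotarev gives infinitely many primes, and one avoids `S₀ ∪ {q ∣ n₁ n₂}`.
[cite: McCallumLMS1991, §3 Cor. 3.2; §5 proof of Prop. 5.2] [cite: Kolyvagin1991MathAnn, Thm. 2.1] [cite: GrossLMS1991, Prop. 5.4, Prop. 6.2 (1)] -/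
theorem exists_deep_kolyvaginPrime_fullOrder_pair_of_data [NeZero (W.conductorNorm ℤ)] (hcm : ¬ W.HasCM) (hΔ : W.Δ < 0)
    (hT : Odd W.tamagawaProduct) (hρ : ∀ n : ℕ, W.HasSurjectiveModNGaloisRep (2 ^ n : ℕ))
    {K : Type} [Field K] [NumberField K] (hK : IsImaginaryQuadratic K) (hodd : Odd (NumberField.discr K))
    (h3 : NumberField.discr K ≠ -3) (hH : SatisfiesHeegnerHypothesis (W.conductorNorm ℤ) K)
    (hns : ¬ IsSquare ((NumberField.discr K : ℚ) * -|W.Δ|)) (σ : K ≃ₐ[ℚ] K) (hσ : σ ≠ 1)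
    {Dt : ModularForms.ModularParametrizationData W (W.conductorNorm ℤ)} {β : ℤ} {ι : K →+* ℂ} {L : ℕ} (hL : 1 ≤ L)
    (hNPh : ∀ z : galH1Torsion (W.baseChange K) ((2 ^ L : ℕ) : ℤ),
      (∀ ρ ∈ torsionFixing (W.baseChange K) ((2 ^ L : ℕ) : ℤ), h1Eval (W.baseChange K) ((2 ^ L : ℕ) : ℤ) z ρ = 0) →
      (∀ w : HeightOneSpectrum (𝓞 K), z ∈ selmerLocalKer (W.baseChange K) (w.adicCompletion K) ((2 ^ L : ℕ) : ℤ)) → z = 0)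
    {n₁ n₂ : ℕ} (hn₁ : Squarefree n₁) (hn₂ : Squarefree n₂)
    (hK₁ : ∀ q ∈ n₁.primeFactors, Zhang2014.IsKolyvaginPrime (W.conductorNorm ℤ) W K 2 q ∧ L ≤ Zhang2014.kolyvaginIndex W 2 q)
    (hK₂ : ∀ q ∈ n₂.primeFactors, Zhang2014.IsKolyvaginPrime (W.conductorNorm ℤ) W K 2 q ∧ L ≤ Zhang2014.kolyvaginIndex W 2 q)
    (d₁ : KolyvaginHeegnerData Dt β ι n₁) (d₂ : KolyvaginHeegnerData Dt β ι n₂) {a b : ℕ} (ha : 1 ≤ a) (hb : 1 ≤ b)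
    (hord₁ : addOrderOf (d₁.kolyvaginClass Nat.prime_two L) = 2 ^ a) (hord₂ : addOrderOf (d₂.kolyvaginClass Nat.prime_two L) = 2 ^ b)
    (S₀ : Finset ℕ) :
    ∃ ℓ : ℕ, ℓ ∉ S₀ ∧ ℓ ∉ n₁.primeFactors ∧ ℓ ∉ n₂.primeFactors ∧
      Zhang2014.IsKolyvaginPrime (W.conductorNorm ℤ) W K 2 ℓ ∧ L ≤ Zhang2014.kolyvaginIndex W 2 ℓ ∧ FrobEqFrobInfty W K (2 ^ L) ℓ ∧
      ∀ v : HeightOneSpectrum (𝓞 K), (ℓ : 𝓞 K) ∈ v.asIdeal →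
        (∀ j : ℕ, ((2 ^ j : ℕ) : ℤ) • d₁.kolyvaginClass Nat.prime_two L ∈
            (W.baseChange K).torsionLocalKer (v.adicCompletion K) ((2 ^ L : ℕ) : ℤ) ↔ a ≤ j) ∧
        ∀ j : ℕ, ((2 ^ j : ℕ) : ℤ) • d₂.kolyvaginClass Nat.prime_two L ∈
            (W.baseChange K).torsionLocalKer (v.adicCompletion K) ((2 ^ L : ℕ) : ℤ) ↔ b ≤ j := by
  haveI : Fact (Nat.Prime 2) := ⟨Nat.prime_two⟩
  have h4 : NumberField.discr K ≠ -4 := by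
    intro h
    have hD : NumberField.discr K < -4 := by
      have hgt : 2 < |NumberField.discr K| := NumberField.abs_discr_gt_two (by rw [hK.1]; exact one_lt_two)
      rw [abs_of_neg hK.discr_neg] at hgt
      obtain ⟨r, hr⟩ := hodd
      omega
    omega
  have hsurj1 : W.HasSurjectiveModNGaloisRep ((2 : ℤ) ^ 1) := by simpa using hρ 1
  have hsurjk : ∀ j : ℕ, W.HasSurjectiveModNGaloisRep ((2 ^ j : ℕ) : ℤ) := fun j ↦ by exact_mod_cast hρ j
  set x := d₁.kolyvaginClass Nat.prime_two L with hx_def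
  set y := d₂.kolyvaginClass Nat.prime_two L with hy_def
  -- ### signs (Gross 5.4 at `2`)
  obtain ⟨hs₁, hτ₁⟩ := KolyvaginClassSign.sign_conjAct_kolyvaginClass_two hK h3 h4 hodd hH hsurj1 σ hσ Dt β ι hn₁ hL hK₁ d₁
  obtain ⟨hs₂, hτ₂⟩ := KolyvaginClassSign.sign_conjAct_kolyvaginClass_two hK h3 h4 hodd hH hsurj1 σ hσ Dt β ι hn₂ hL hK₂ d₂
  -- ### the places of the primes of `n₁ n₂`
  set T : Finset (Place ℚ) := ((n₁.primeFactors ∪ n₂.primeFactors).subtype Nat.Prime).image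
    (fun p ↦ (Sum.inr ((primesEquiv (R := 𝓞 ℚ)).symm p) : Place ℚ)) with hT_def
  have hTmem : ∀ {v : HeightOneSpectrum (𝓞 ℚ)} {q : ℕ}, q ∈ n₁.primeFactors ∪ n₂.primeFactors → (q : 𝓞 ℚ) ∈ v.asIdeal →
      (Sum.inr v : Place ℚ) ∈ T := by
    intro v q hq hqv
    have hqp : q.Prime := by
      rcases Finset.mem_union.mp hq with h | h <;> exact Nat.prime_of_mem_primeFactors h
    rw [hT_def, Finset.mem_image]
    refine ⟨⟨q, hqp⟩, Finset.mem_subtype.mpr hq, ?_⟩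
    rw [(natCast_prime_mem_iff_eq hqp v).mp hqv]
  have hTdesc : ∀ u ∈ T, ∃ (v : HeightOneSpectrum (𝓞 ℚ)) (ℓ : ℕ), u = Sum.inr v ∧ ℓ.Prime ∧ (ℓ : 𝓞 ℚ) ∈ v.asIdeal ∧
      Zhang2014.IsKolyvaginPrime (W.conductorNorm ℤ) W K 2 ℓ ∧ L ≤ Zhang2014.kolyvaginIndex W 2 ℓ := by
    intro u hu
    rw [hT_def, Finset.mem_image] at hu
    obtain ⟨p, hp, rfl⟩ := hu
    have hpS := Finset.mem_subtype.mp hp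
    refine ⟨_, p.1, rfl, p.2, natCast_mem_primesEquiv_symm p.2, ?_⟩
    rcases Finset.mem_union.mp hpS with h | h
    · exact hK₁ _ h
    · exact hK₂ _ h
  -- ### the classes are Selmer off `T` (Gross 6.2(1) at `2`)
  have hsel : ∀ {n : ℕ} (hn : Squarefree n)
      (hKn : ∀ q ∈ n.primeFactors, Zhang2014.IsKolyvaginPrime (W.conductorNorm ℤ) W K 2 q ∧ L ≤ Zhang2014.kolyvaginIndex W 2 q)
      (hsub : n.primeFactors ⊆ n₁.primeFactors ∪ n₂.primeFactors) (d : KolyvaginHeegnerData Dt β ι n)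
      (w : HeightOneSpectrum (𝓞 K)), (Sum.inr (w.under (𝓞 ℚ)) : Place ℚ) ∉ T →
      d.kolyvaginClass Nat.prime_two L ∈ selmerLocalKer (W.baseChange K) (w.adicCompletion K) ((2 ^ L : ℕ) : ℤ) := by
    intro n hn hKn hsub d w hw
    refine RankOneAtTwoOneDoor.kolyvaginClass_two_mem_selmerLocalKer_of_odd_tamagawaProduct W hsurjk hT K hK h3 h4 hH Dt β ι L
      hn hKn d w fun hnw ↦ ?_
    haveI : w.asIdeal.LiesOver (w.under (𝓞 ℚ)).asIdeal := ⟨rfl⟩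
    obtain ⟨q, hq, hqv⟩ := exists_primeFactor_natCast_mem_of_natCast_mem hn.ne_zero (w.under (𝓞 ℚ)) w hnw
    exact hw (hTmem (hsub hq) hqv)
  -- ### Q5R's separation hypothesis for `⟨x, y⟩` from (NPh_L)
  have hres : ∀ a' b' : ℤ, (∀ ρ ∈ torsionFixing (W.baseChange K) ((2 ^ L : ℕ) : ℤ),
      h1Eval (W.baseChange K) ((2 ^ L : ℕ) : ℤ) (a' • x + b' • y) ρ = 0) → a' • x + b' • y = 0 := by
    intro a' b' hab
    refine eq_zero_of_phantom_of_selmer_outside_pow W hK T hTdesc hNPh hab fun w hw ↦ ?_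
    exact add_mem (AddSubgroup.zsmul_mem _ (hsel hn₁ hK₁ Finset.subset_union_left d₁ w hw) a')
      (AddSubgroup.zsmul_mem _ (hsel hn₂ hK₂ Finset.subset_union_right d₂ w hw) b')
  -- ### the pair Čebotarev, avoiding `S₀` and the primes of `n₁ n₂`
  have hinf := PlusDescent.infinite_kolyvaginPrime_localization_fullOrder_pair (W.conductorNorm ℤ) W hcm hΔ K hK hns hρ σ hσ L hL
    x y ha hb hord₁ hord₂ hs₁ hs₂ hτ₁ hτ₂ hres
  obtain ⟨ℓ, hℓmem, hℓE⟩ := hinf.exists_notMem_finset (S₀ ∪ (n₁.primeFactors ∪ n₂.primeFactors))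
  obtain ⟨hFrob, hKol, hidx, hloc⟩ := hℓmem
  simp only [Finset.mem_union, not_or] at hℓE
  obtain ⟨hℓS₀, hℓn₁, hℓn₂⟩ := hℓE
  exact ⟨ℓ, hℓS₀, hℓn₁, hℓn₂, hKol, hidx, hFrob, fun v hv ↦ hloc v hv⟩

end Pair

end Summit.BirchSwinnertonDyer.BirchSwinnertonDyer.Theorems.GenusExact.RelaxedCount

end
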